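import Mathlib
import Literature.Geometry.Lorentzian.LorentzianMetricProofs
import Literature.Geometry.Lorentzian.Causality
import Literature.Geometry.Lorentzian.Einstein
import Literature.Geometry.Lorentzian.KillingHorizonShadowAlong
import Literature.Geometry.Lorentzian.CausalCurveEndpoint
import HarnessLib

/-!
# KillingDevelopment

Topic `Literature/Geometry/Lorentzian`. Named literature fact(s) relocated by the gate from `Summits/FinalStateConjecture/FinalStateConjecture/Theorems/BartnikGapSettlingBondiBartnikRigidityKillingPropagationOfFacts.lean`
(accept-time relocation of `[cite]`d propositions written inline in a Summits proposal; human ruling 2026-08-15).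
Sources: FischerMarsdenMoncrief1980, Geroch1970, HawkingEllis1973CUP, Moncrief1975.

* `Literature.Geometry.Lorentzian.fischerMarsdenMoncrief_killing_development`
* `Literature.Geometry.Lorentzian.geroch1970_exists_isCauchyHypersurface`
-/

namespace Literature.Geometry.Lorentzian

open Set Filter Function Topology TopologicalSpace
open Literature.Geometry.Lorentzian
open scoped Manifold ContDiff Topology ENNReal

/-- **Fischer–Marsden–Moncrief / Moncrief Killing development** (named published fact, stated for
a general vacuum `Spacetime 4`; dimension `3 + 1`, the case of the sources).  In a Ricci-flat
spacetime `𝒮`, let `G` be an open region with a Cauchy hypersurface `Sc` (O'Neill's notion, for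
the open sub-spacetime `(G, g|_G, τ|_G)`), and let `ξ` be a Killing field on an open set `U` with
`Sc ⊆ U ⊆ G`.  Then there is a Killing field `ξ'` of `g` on the whole region `G` which coincides
with `ξ` on an open set `U'`, `Sc ⊆ U' ⊆ U`.  Sources: V. Moncrief, J. Math. Phys. 16 (1975) 493,
§III (the Killing initial data of `ξ` on a Cauchy surface of a vacuum spacetime develop, through
the hyperbolic system `□ξ' + Ric·ξ' = 0`, to a Killing field of the whole Cauchy development,
unique given the data); A. Fischer, J. Marsden, V. Moncrief, Ann. IHP A 33 (1980) 147, Lemma 2.2;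
the passage from a topological Cauchy hypersurface `Sc ⊆ U` to a smooth spacelike one inside `U`
is Bernal–Sánchez, Lett. Math. Phys. 77 (2006) 183, and `ξ' = ξ` on the component of `U` through
`Sc` is the unique continuation of Killing fields (O'Neill 1983, Ch. 9, Lemma 9.28).  Wanted by
the Killing-propagation step β' of K1a (line `direct-method-on-the-cone`, crux
`BondiBartnikRigidity`); the tree has only the coordinate LOCAL core
`MetricCoord.GaussSlice.exists_coordKilling_of_kid` (`CoordKillingDevelopment.lean`).
[cite: Moncrief1975, §III] [cite: FischerMarsdenMoncrief1980, Lemma 2.2]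
[file Geometry/Lorentzian/KillingDevelopment] -/
def fischerMarsdenMoncrief_killing_development : Prop :=
  ∀ (𝒮 : Literature.Geometry.Lorentzian.Spacetime.{0} 4)
    [𝒮.metric.toPseudoRiemannianMetric.HasLeviCivita],
    𝒮.metric.toPseudoRiemannianMetric.IsRicciFlat →
    ∀ (G : TopologicalSpace.Opens 𝒮.carrier) (U Sc : Set 𝒮.carrier)
      (ξ : (y : 𝒮.carrier) → TangentSpace (modelWithCornersSelf ℝ (EuclideanSpace ℝ (Fin 4))) y),
    (𝒮.metric.restrict Literature.Geometry.Lorentzian.PseudoRiemannianMetric.contMDiff_restrict_holds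
        G).IsCauchyHypersurface
      (𝒮.timeOrientation.restrict
        Literature.Geometry.Lorentzian.PseudoRiemannianMetric.contMDiff_restrict_holds
        𝒮.timeOrientation.contMDiff_restrict_holds G) (Subtype.val ⁻¹' Sc) →
    Sc ⊆ U → IsOpen U → U ⊆ (G : Set 𝒮.carrier) → 𝒮.metric.IsKillingFieldOn ξ U →
    ∃ ξ' : (y : 𝒮.carrier) → TangentSpace (modelWithCornersSelf ℝ (EuclideanSpace ℝ (Fin 4))) y,
      𝒮.metric.IsKillingFieldOn ξ' (G : Set 𝒮.carrier) ∧
      ∃ U' : Set 𝒮.carrier, IsOpen U' ∧ Sc ⊆ U' ∧ U' ⊆ U ∧ ∀ y ∈ U', ξ' y = ξ y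

/-- **Geroch's splitting theorem, existence half** (named published fact): a globally hyperbolic
time-oriented `Cⁿ` (`n ≥ 2`) Lorentzian manifold — Hausdorff, second countable, without boundary,
finite-dimensional — admits a Cauchy hypersurface (a set met exactly once by every endless timelike
curve, `LorentzianMetric.IsCauchyHypersurface`).  R. Geroch, J. Math. Phys. 11 (1970) 437, Thm. 11
("`M` is globally hyperbolic if and only if it possesses a Cauchy surface"); Hawking–Ellis 1973,
Prop. 6.6.8; with the tree's Bernal–Sánchez form of `IsGloballyHyperbolic` (causal + compact causal
diamonds) equivalent to the classical one by Bernal–Sánchez, Class. Quantum Grav. 24 (2007) 745,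
Thm. 3.2.  This is the direction "globally hyperbolic → Cauchy hypersurface" of the wanted fact
`isGloballyHyperbolic_iff_exists_isCauchyHypersurface` announced in the module docstring of
`Literature/Geometry/Lorentzian/Causality.lean` (the converse is proved in the tree for `C^∞`
metrics, `IsCauchyHypersurface.isGloballyHyperbolic`).
[cite: Geroch1970, Thm. 11] [cite: HawkingEllis1973CUP, §6.6, Prop. 6.6.8]
[file Geometry/Lorentzian/GerochSplitting] -/
def geroch1970_exists_isCauchyHypersurface : Prop :=
  ∀ {E : Type} [NormedAddCommGroup E] [NormedSpace ℝ E] [FiniteDimensional ℝ E] {H : Type}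
    [TopologicalSpace H] {I : ModelWithCorners ℝ E H} {n : WithTop ℕ∞} {M : Type}
    [TopologicalSpace M] [ChartedSpace H M] [IsManifold I ((⊤ : ℕ∞) : WithTop ℕ∞) M] [T2Space M]
    [SecondCountableTopology M] [BoundarylessManifold I M]
    (g : Literature.Geometry.Lorentzian.LorentzianMetric I n M)
    (τ : Literature.Geometry.Lorentzian.TimeOrientation g),
    2 ≤ n → g.IsGloballyHyperbolic τ → ∃ S : Set M, g.IsCauchyHypersurface τ S

end Literature.Geometry.Lorentzian
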